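import Summits.QuantumFields.GaugeBoot.Rung0D3Binding
import HarnessLib

/-!
# Witness-coded canonical relabelling of loop variables (cell `gauge-boot`, LEQ-SCALING R1)

Cell `pub-gaugeboot` (HOME `run/shared/lean/pub/pub-gaugeboot/`), seat lean2 — design note `HOME/pub-gaugeboot-lean2/LEQ-SCALING.md`
(rows-as-data: the large equality systems `𝓔` of the cell's `SU(2)` problem files — glyz-c2 3D 408 rows, kz-L2 3D 755 / 1939
rows — as kernel theorems from ONE soundness theorem plus `decide`-checked data, instead of one module per dozen rows).

HONEST FRAMING (page 1 of every file of this cell): certified bounds on lattice expectations at STATED coupling, gauge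
group, dimension and torus size; NOT a mass gap, NOT a continuum limit, NOT a string tension, NOT large `N`; NOT
Yang–Mills-summit-bearing (barriers `FixedCouplingUltralocality`, `PerturbativeInvisibility`).

## Content

The generators' variables are CANONICAL loop words (eng1 G1 `canonical_loop`: lexicographically least image of the cyclically
reduced word under rotations × reversal × `B₃`).  lean1's `LoopClasses.Word.canon ms rev k₁ k₂ w` carries a raw closed word to
such a representative along hyperoctahedral moves, reversal, rotation, free reduction, rotation, preserving `⟨W_0(·)⟩`
(`wilsonExpectation_wordLoop_canon`, hypothesis `disp (acts ms w) = 0`).  This file makes that pipeline DATA-DRIVEN: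

* `Word.disp_map_act_eq_zero_iff`, `Word.disp_acts` — hyperoctahedral moves preserve closedness, so the hypothesis of the
  master lemma reduces to `disp w = 0` (closedness of the raw word, itself decidable);
* `b3 g` — the 48 elements of `B₃` as move lists (code `g = 8·p + s`: `p < 6` a permutation as a product of transpositions,
  `s < 8` the sign bits), and `Word.canonW c w` — ONE natural-number WITNESS CODE `c = g + 64·rev + 128·k₁ + 4096·k₂`
  selecting the element, the reversal flag and the two rotations;
* `W_canonW` : `Rung0D3.W β L (w.canonW c) = Rung0D3.W β L w` for every closed `w` and EVERY code `c` (so a row generator may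
  relabel its terms by untrusted witness codes found by search outside the kernel; soundness never depends on them), and
  `W_canonW_at` (the same from any base point, by translation invariance).
Everything is `[folklore]`.
-/

noncomputable section

open MeasureTheory
open Literature.MathematicalPhysics.QuantumFieldTheory

namespace Summit.QuantumFields.GaugeBoot

/-! ## Hyperoctahedral moves preserve closedness -/

namespace Step

variable {d : ℕ}

/-- Displacement of a permuted step: `disp (π·s) k = disp s (π⁻¹ k)`. [folklore] -/
theorem disp_permute (π : Equiv.Perm (Fin d)) (s : Step d) (k : Fin d) : (s.permute π).disp k = s.disp (π.symm k) := by
  have hk : ∀ μ : Fin d, (Pi.single (π μ) (1 : ℤ) : Fin d → ℤ) k = (Pi.single μ (1 : ℤ) : Fin d → ℤ) (π.symm k) := by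
    intro μ
    by_cases h : k = π μ
    · subst h; simp
    · have h' : π.symm k ≠ μ := fun h'' => h (by rw [← h'', Equiv.apply_symm_apply])
      rw [Pi.single_eq_of_ne h, Pi.single_eq_of_ne h']
  cases s with
  | fwd μ => simp only [permute_fwd, disp, hk]
  | bwd μ => simp only [permute_bwd, disp, Pi.neg_apply, hk]

/-- Displacement of a step with axis `j` reflected: the `j`-component changes sign. [folklore] -/
theorem disp_reflectAxis (j : Fin d) (s : Step d) (k : Fin d) :
    (s.reflectAxis j).disp k = if k = j then -s.disp k else s.disp k := by
  cases s with
  | fwd μ =>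
    by_cases h : μ = j
    · subst h
      by_cases hk : k = μ
      · subst hk; simp [reflectAxis, disp]
      · simp [reflectAxis, disp, hk]
    · by_cases hk : k = j
      · subst hk
        have hk' : k ≠ μ := fun e => h e.symm
        simp [reflectAxis, disp, h]
      · simp [reflectAxis, disp, h, hk]
  | bwd μ =>
    by_cases h : μ = j
    · subst h
      by_cases hk : k = μ
      · subst hk; simp [reflectAxis, disp]
      · simp [reflectAxis, disp, hk]
    · by_cases hk : k = j
      · subst hk
        have hk' : k ≠ μ := fun e => h e.symm
        simp [reflectAxis, disp, h]
      · simp [reflectAxis, disp, h, hk]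

end Step

namespace Word

variable {d : ℕ}

/-- `disp (π·w) k = disp w (π⁻¹ k)`. [folklore] -/
theorem disp_map_permute (π : Equiv.Perm (Fin d)) (w : Word d) (k : Fin d) :
    disp (w.map (Step.permute π)) k = disp w (π.symm k) := by
  induction w with
  | nil => simp
  | cons s w ih => simp only [List.map_cons, disp_cons, Pi.add_apply, ih, Step.disp_permute]

/-- Reflecting axis `j` changes the sign of the `j`-component of the displacement. [folklore] -/
theorem disp_map_reflectAxis (j : Fin d) (w : Word d) (k : Fin d) :
    disp (w.map (Step.reflectAxis j)) k = if k = j then -disp w k else disp w k := by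
  induction w with
  | nil => simp
  | cons s w ih =>
    simp only [List.map_cons, disp_cons, Pi.add_apply, ih, Step.disp_reflectAxis]
    split_ifs <;> ring

variable [NeZero d]

/-- `reflect0 = reflectAxis 0` on words. [folklore] -/
theorem map_reflect0_eq (w : Word d) : w.map Step.reflect0 = w.map (Step.reflectAxis 0) :=
  List.map_congr_left fun s _ => (Step.reflectAxis_zero s).symm

/-- **A hyperoctahedral move preserves closedness** (and non-closedness). [folklore] -/
theorem disp_map_act_eq_zero_iff (m : Move d) (w : Word d) : disp (w.map m.act) = 0 ↔ disp w = 0 := by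
  cases m with
  | perm π =>
    show disp (w.map (Step.permute π)) = 0 ↔ disp w = 0
    constructor
    · intro h; funext k
      have := congrFun h (π k)
      rw [disp_map_permute, Equiv.symm_apply_apply] at this
      simpa using this
    · intro h; funext k
      rw [disp_map_permute, h]; rfl
  | refl0 =>
    show disp (w.map Step.reflect0) = 0 ↔ disp w = 0
    rw [map_reflect0_eq]
    constructor
    · intro h; funext k
      have := congrFun h k
      rw [disp_map_reflectAxis] at this
      split_ifs at this with hk
      · simpa using this
      · simpa using this
    · intro h; funext k
      rw [disp_map_reflectAxis, h]; simp
  | refl j =>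
    show disp (w.map (Step.reflectAxis j)) = 0 ↔ disp w = 0
    constructor
    · intro h; funext k
      have := congrFun h k
      rw [disp_map_reflectAxis] at this
      split_ifs at this with hk
      · simpa using this
      · simpa using this
    · intro h; funext k
      rw [disp_map_reflectAxis, h]; simp

/-- **A list of moves preserves closedness**: the hypothesis of `wilsonExpectation_wordLoop_canon` reduces to
`disp w = 0`. [folklore] -/
theorem disp_acts (ms : List (Move d)) {w : Word d} (hw : disp w = 0) : disp (acts ms w) = 0 := by
  induction ms with
  | nil => simpa using hw
  | cons m ms ih => rw [acts_cons]; exact (disp_map_act_eq_zero_iff m _).2 ih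

end Word

/-! ## The 48 elements of `B₃` as move lists, and witness codes -/

/-- The permutation part of a `B₃` code (`p = 0 … 5`; as products of transpositions; other values: identity). [folklore] -/
def b3Perm : ℕ → List (Move 3)
  | 1 => [Move.perm (Equiv.swap 0 1)]
  | 2 => [Move.perm (Equiv.swap 0 2)]
  | 3 => [Move.perm (Equiv.swap 1 2)]
  | 4 => [Move.perm (Equiv.swap 0 1), Move.perm (Equiv.swap 0 2)]
  | 5 => [Move.perm (Equiv.swap 0 2), Move.perm (Equiv.swap 0 1)]
  | _ => []

/-- The sign part of a `B₃` code (`s < 8`: bit `j` set = reflect axis `j`). [folklore] -/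
def b3Sign (s : ℕ) : List (Move 3) :=
  (if s % 2 = 1 then [Move.refl 0] else []) ++ (if s / 2 % 2 = 1 then [Move.refl 1] else []) ++
    (if s / 4 % 2 = 1 then [Move.refl 2] else [])

/-- The `B₃` element of code `g = 8·p + s` as a move list (signs act first, `Word.acts` convention). [folklore] -/
def b3 (g : ℕ) : List (Move 3) := b3Perm (g / 8) ++ b3Sign (g % 8)

namespace Word

/-- **Witness-coded canonicalisation**: the code `c = g + 64·rev + 128·k₁ + 4096·k₂` (`g < 64`, `rev < 2`, `k₁ < 32`)
selects `LoopClasses.Word.canon (b3 g) rev k₁ k₂`: hyperoctahedral element, optional reversal, rotation by `k₁`, free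
reduction, rotation by `k₂`. [folklore] -/
def canonW (c : ℕ) (w : Word 3) : Word 3 :=
  Word.canon (b3 (c % 64)) (decide (c / 64 % 2 = 1)) (c / 128 % 32) (c / 4096) w

/-- `canonW` preserves closedness. [folklore] -/
theorem disp_canonW (c : ℕ) {w : Word 3} (hw : disp w = 0) : disp (w.canonW c) = 0 := by
  unfold canonW Word.canon
  have h := disp_acts (b3 (c % 64)) hw
  split_ifs <;> simp [h]

end Word

/-- **Relabelling by ANY witness code preserves the loop variable**: `Rung0D3.W β L (w.canonW c) = Rung0D3.W β L w` for a
closed word `w` (standard coupling `β`, torus `(ℤ/L)³`, `SU(2)`). [folklore] -/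
theorem W_canonW (β : ℝ) (L : ℕ) [NeZero L] (c : ℕ) (w : Word 3) (hw : Word.disp w = 0) :
    Rung0D3.W β L (w.canonW c) = Rung0D3.W β L w := by
  unfold Rung0D3.W Word.canonW
  exact (wilsonExpectation_wordLoop_canon (suRep 2) (continuous_suRep 2) _ _ _ _ _ _ (Word.disp_acts _ hw)).symm

/-- **The same from any base point** `x` of the torus (translation invariance, `wilsonExpectation_wordLoop_translate`):
`⟨W_x(w)⟩ = Rung0D3.W β L (w.canonW c)`. [folklore] -/
theorem W_canonW_at (β : ℝ) {L : ℕ} [NeZero L] (x : Site 3 L) (c : ℕ) (w : Word 3) (hw : Word.disp w = 0) :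
    wilsonExpectation (suRep 2) (β / (2 : ℕ)) (wordLoop (suRep 2) x w) = Rung0D3.W β L (w.canonW c) := by
  rw [W_canonW β L c w hw, wilsonExpectation_wordLoop_translate (suRep 2) (β / (2 : ℕ)) x (0 : Site 3 L) w]
  rfl

/-- Example: the code `320 = 0 + 64·1 + 128·2 + 4096·0` (identity of `B₃`, reversed, rotations `2, 0`) carries
`−1 −0 +1 +0` to the plaquette label `+0 +1 −0 −1` (closed computation). [folklore] -/
example : Word.canonW 320 [.bwd 1, .bwd 0, .fwd 1, .fwd 0] = [.fwd 0, .fwd 1, .bwd 0, .bwd 1] := by decide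

end Summit.QuantumFields.GaugeBoot

end
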